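import Mathlib
import HarnessLib
import Literature.Analysis.PDE.BanachIndicatrixLaplacianBound

/-!
# Route `UnthreadedDoor`, crux `PoloidalLiouville` (stmt-NavierStokesRegularity-1222), WALL W1 — crux idea «indicatrix-bound», Λ-0b+c steps (ii)–(iii):
# invariances of the Banach indicatrix (homeomorphisms of the level sets; constant shifts of the function)

Two of the five elementary steps of the custodian's Λ-0b+c bridge `PolterovichSodin2007_indicatrix_sphere → IndicatrixLeHessian`
(`Cruxes/PoloidalLiouville/IndicatrixSketch.lean` v1.7.3, docstring of `IndicatrixLeHessian`), for the Literature notion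
`Literature.Analysis.PDE.banachIndicatrix S f = ∫⁻ c, #components(S ∩ f⁻¹{c})`:
* ★ `levelComponentCount_image_homeomorph` / `banachIndicatrix_image_homeomorph` — for a homeomorphism `h : X ≃ₜ Y`:
  `banachIndicatrix (h '' S) f = banachIndicatrix S (f ∘ h)` (step (ii), AFFINE INVARIANCE, with `h = (σ ↦ x₀ + r • σ)`:
  `banachIndicatrix (sphere x₀ r) f = banachIndicatrix (sphere 0 1) (f ∘ A)`, spelled out as `banachIndicatrix_sphere_affine`);
* ★ `banachIndicatrix_sub_const` — `banachIndicatrix S (fun x => f x - a) = banachIndicatrix S f` (step (iii), CONSTANT SHIFT: the level integral is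
  translation-invariant in `c`).
Steps (iv) (zeroth-order term from sphere data) and (v) (the Laplacian of the degree-`0` extension) are NOT here.  Pure topology/measure theory;
nothing here is an NS statement; ⟨1222⟩ / W1 / NS regularity OPEN.  `--supports stmt-NavierStokesRegularity-1222 --as helper`.  [folklore]
-/

noncomputable section

-- the summit and its single sub-problem share the name (CONVENTIONS §1)
set_option linter.dupNamespace false

open Set Function Filter Topology MeasureTheory
open scoped ENNReal

namespace Summit.NavierStokesRegularity.NavierStokesRegularity.Theorems.PoloidalLiouville.Indicatrix

open Literature.Analysis.PDE

/-! ### (ii) homeomorphism invariance -/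

/-- The level-set component count is invariant under homeomorphisms: `β(c, f, h '' S) = β(c, f ∘ h, S)`. [folklore] -/
theorem levelComponentCount_image_homeomorph {X Y : Type*} [TopologicalSpace X] [TopologicalSpace Y] (h : X ≃ₜ Y) (S : Set X)
    (f : Y → ℝ) (c : ℝ) : levelComponentCount (h '' S) f c = levelComponentCount S (f ∘ h) c := by
  unfold levelComponentCount
  -- the level set of `f` on `h '' S` is the image of the level set of `f ∘ h` on `S`
  have hlev : h '' S ∩ f ⁻¹' {c} = h '' (S ∩ (f ∘ h) ⁻¹' {c}) := by
    ext y
    constructor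
    · rintro ⟨⟨x, hx, rfl⟩, hy⟩
      exact ⟨x, ⟨hx, hy⟩, rfl⟩
    · rintro ⟨x, ⟨hx, hy⟩, rfl⟩
      exact ⟨⟨x, hx, rfl⟩, hy⟩
  rw [hlev]
  set L : Set X := S ∩ (f ∘ h) ⁻¹' {c} with hL
  -- components correspond under `h`
  have himg : connectedComponentIn (h '' L) '' (h '' L) = (Set.image h) '' (connectedComponentIn L '' L) := by
    ext C
    constructor
    · rintro ⟨_, ⟨x, hx, rfl⟩, rfl⟩
      exact ⟨connectedComponentIn L x, ⟨x, hx, rfl⟩, h.image_connectedComponentIn hx⟩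
    · rintro ⟨_, ⟨x, hx, rfl⟩, rfl⟩
      exact ⟨h x, ⟨x, hx, rfl⟩, (h.image_connectedComponentIn hx).symm⟩
  rw [himg, (Set.image_injective.mpr h.injective).injOn.encard_image]

/-- **Step (ii): the Banach indicatrix is invariant under homeomorphisms**, `Λ_{h(S)}(f) = Λ_S(f ∘ h)`. [folklore] -/
theorem banachIndicatrix_image_homeomorph {X Y : Type*} [TopologicalSpace X] [TopologicalSpace Y] (h : X ≃ₜ Y) (S : Set X)
    (f : Y → ℝ) : banachIndicatrix (h '' S) f = banachIndicatrix S (f ∘ h) := by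
  simp only [banachIndicatrix_eq, levelComponentCount_image_homeomorph]

/-- The affine similarity `σ ↦ x₀ + r • σ` (`r ≠ 0`), i.e. `(Homeomorph.smulOfNeZero r _).trans (Homeomorph.addLeft x₀)`, maps the unit sphere onto
`S_r(x₀)` (`0 < r`). [folklore] -/
theorem affine_image_unitSphere {E : Type*} [NormedAddCommGroup E] [NormedSpace ℝ E] (x₀ : E) {r : ℝ} (hr : 0 < r) :
    ((Homeomorph.smulOfNeZero r hr.ne').trans (Homeomorph.addLeft x₀)) '' Metric.sphere (0 : E) 1 = Metric.sphere x₀ r := by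
  ext y
  simp only [mem_image, mem_sphere_iff_norm, sub_zero, Homeomorph.trans_apply, Homeomorph.smulOfNeZero_apply,
    Homeomorph.coe_addLeft]
  constructor
  · rintro ⟨σ, hσ, rfl⟩
    rw [add_sub_cancel_left, norm_smul, Real.norm_eq_abs, abs_of_pos hr, hσ, mul_one]
  · intro hy
    refine ⟨r⁻¹ • (y - x₀), ?_, ?_⟩
    · rw [norm_smul, Real.norm_eq_abs, abs_inv, abs_of_pos hr, hy, inv_mul_cancel₀ hr.ne']
    · rw [smul_smul, mul_inv_cancel₀ hr.ne', one_smul, add_sub_cancel]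

/-- **Step (ii) on spheres: `Λ_{S_r(x₀)}(f) = Λ_{S²}(f ∘ A)`** with `A σ = x₀ + r • σ`. [folklore] -/
theorem banachIndicatrix_sphere_affine {E : Type*} [NormedAddCommGroup E] [NormedSpace ℝ E] (x₀ : E) {r : ℝ} (hr : 0 < r) (f : E → ℝ) :
    banachIndicatrix (Metric.sphere x₀ r) f = banachIndicatrix (Metric.sphere (0 : E) 1) (fun σ => f (x₀ + r • σ)) := by
  rw [← affine_image_unitSphere x₀ hr, banachIndicatrix_image_homeomorph]
  congr 1

/-! ### (iii) constant shifts -/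

/-- The level sets of `f − a` are the level sets of `f`, shifted: `β(c, f − a) = β(c + a, f)`. [folklore] -/
theorem levelComponentCount_sub_const {X : Type*} [TopologicalSpace X] (S : Set X) (f : X → ℝ) (a c : ℝ) :
    levelComponentCount S (fun x => f x - a) c = levelComponentCount S f (c + a) := by
  unfold levelComponentCount
  have hlev : S ∩ (fun x => f x - a) ⁻¹' {c} = S ∩ f ⁻¹' {c + a} := by
    ext x
    simp only [mem_inter_iff, mem_preimage, mem_singleton_iff, sub_eq_iff_eq_add]
  rw [hlev]

/-- **Step (iii): the Banach indicatrix is invariant under constant shifts of the function**, `Λ_S(f − a) = Λ_S(f)` (translation invariance of the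
level integral). [folklore] -/
theorem banachIndicatrix_sub_const {X : Type*} [TopologicalSpace X] (S : Set X) (f : X → ℝ) (a : ℝ) :
    banachIndicatrix S (fun x => f x - a) = banachIndicatrix S f := by
  simp only [banachIndicatrix_eq, levelComponentCount_sub_const]
  exact lintegral_add_right_eq_self (μ := volume) (fun c => ((levelComponentCount S f c : ℕ∞) : ℝ≥0∞)) a

end Summit.NavierStokesRegularity.NavierStokesRegularity.Theorems.PoloidalLiouville.Indicatrix

end
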